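import Summits.Ventures.HodgeRepro2.T5InertPlaceCompletion
import Summits.Ventures.HodgeRepro2.T5InertHeckeCells

/-!
# The cell basis of the record's spherical Hecke algebra on Mathlib's adic completions
(Tier-5 support, N3)

`T5InertPlaceCompletion` put the commutativity half of the inert-place package on the record's
local fields `Kv ⊆ Lw` (Mathlib's `adicCompletion` at places `w ∣ v` of number fields `K ⊆ L`).
This file does the same for the VECTOR-SPACE HALF of the Satake isomorphism
(`T5InertHeckeCells.exists_basis_of_isotropic_of_unramified`): for `H` hermitian for the Galois
conjugation of `Lw/Kv`, with entries and inverse in `𝒪_{E_v} = integralClosure O_Kv Lw`, unit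
determinant and an isotropic vector, the spherical Hecke algebra `H(U(H), K_H)` has the basis
`{ε(T_k)}_{k ∈ ℕ}` — the image under the transport `ε : H(U(antidiag(1,u₀,1)), K_U) ≃ₐ[k] H(U(H), K_H)`
of the cells `T_k = T_{diag(ϖ^k, 1, ϖ^{-k})}` of `T5HeckeBasisCells.heckeBasisCells`, `ϖ` a
uniformiser of `O_Kv` that stays one in `O_Lw` (`e(w/v) = 1`). Every instance hypothesis of the
abstract statement is discharged on the concrete pair (`isLocalRing_integralClosure_adicCompletion`,
`isDiscreteValuationRing_integralClosure_adicCompletion`, `T5ResidueFieldFinite`, p4's instances);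
what is left is `[Lw : Kv] = 2`, `e(w/v) = 1`, the Galois conjugation `σ ≠ 1` and the data of `H`.
No L-value anywhere (README §8(d): NO).
-/

namespace Summit.Ventures.HodgeRepro2.T5InertPlaceCompletionCells

open IsDedekindDomain HeightOneSpectrum IsLocalRing T5InertPlaceCompletion

section Completion

variable {K : Type*} [Field K] [NumberField K] (v : HeightOneSpectrum (NumberField.RingOfIntegers K))
  {L : Type*} [Field L] [NumberField L] [Algebra K L]
  (w : HeightOneSpectrum (NumberField.RingOfIntegers L)) [w.asIdeal.LiesOver v.asIdeal]

/-- The residue field of `𝒪_{E_v} = integralClosure O_Kv Lw` is finite (`T5ResidueFieldFinite`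
with the locality of `𝒪_{E_v}` discharged). -/
theorem finite_residueField_integralClosure_adicCompletion :
    haveI := isLocalRing_integralClosure_adicCompletion v w
    Finite (ResidueField (integralClosure (v.adicCompletionIntegers K) (w.adicCompletion L))) :=
  haveI := isLocalRing_integralClosure_adicCompletion v w
  T5ResidueFieldFinite.finite_residueField_integralClosure (v.adicCompletionIntegers K)
    (v.adicCompletion K) (w.adicCompletion L)

/-- **The cell basis on the record's local fields.** For places `w ∣ v` with `[Lw : Kv] = 2` and
`e(w/v) = 1`, `σ` the Galois conjugation, `H` hermitian with entries and inverse in `𝒪_{E_v}`, unit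
determinant and an isotropic vector: there are `u₀ ∈ O_Kvˣ`, a basis `b` of `H(U(H), K_H)` indexed
by `ℕ` and an algebra isomorphism `ε : H(U(antidiag(1,u₀,1)), K_U) ≃ₐ[k] H(U(H), K_H)` with
`b i = ε (T_{cell i})` — `T5InertHeckeCells.exists_basis_of_isotropic_of_unramified` with every
hypothesis on the carrier discharged. -/
theorem exists_basis_adicCompletion
    (h2 : Module.finrank (v.adicCompletion K) (w.adicCompletion L) = 2)
    {ϖ : v.adicCompletionIntegers K} (hϖ : Irreducible ϖ)
    (hinert : Irreducible (algebraMap (v.adicCompletionIntegers K) (w.adicCompletionIntegers L) ϖ))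
    (σ : (w.adicCompletion L) ≃ₐ[v.adicCompletion K] (w.adicCompletion L)) (hσ : σ ≠ 1)
    (H : Matrix (Fin 3) (Fin 3) (w.adicCompletion L)) (k : Type*) [Field k]
    (hH : letI := T5StarOfInvolution.starRingOfQuadratic h2 σ hσ; H.IsHermitian)
    (hHint : ∀ i j, IsLocalization.IsInteger
      (integralClosure (v.adicCompletionIntegers K) (w.adicCompletion L)) (H i j))
    (hHdet : IsUnit H.det)
    (hHinv : ∀ i j, IsLocalization.IsInteger
      (integralClosure (v.adicCompletionIntegers K) (w.adicCompletion L)) (H⁻¹ i j))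
    (x : Fin 3 → w.adicCompletion L) (hx : x ≠ 0)
    (hx0 : letI := T5StarOfInvolution.starRingOfQuadratic h2 σ hσ;
      T5UnitaryGroupIsometry.sesqForm H x x = 0) :
    letI := T5StarOfInvolution.starRingOfQuadratic h2 σ hσ
    haveI := isLocalRing_integralClosure_adicCompletion v w
    haveI := isDiscreteValuationRing_integralClosure_adicCompletion v w
    haveI := finite_residueField_integralClosure_adicCompletion v w
    haveI : IsFractionRing (integralClosure (v.adicCompletionIntegers K) (w.adicCompletion L))
        (w.adicCompletion L) :=
      integralClosure.isFractionRing_of_finite_extension (v.adicCompletion K) (w.adicCompletion L)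
    ∃ (u₀ : (v.adicCompletionIntegers K)ˣ)
      (b : Module.Basis ℕ k (T5HeckePermutationModule.heckeAlgebra k
        (T5UnitaryHeckeAdjoint.hyperspecialSubgroup
          (integralClosure (v.adicCompletionIntegers K) (w.adicCompletion L)) H)))
      (ε : T5HeckePermutationModule.heckeAlgebra k (T5UnitaryHeckeAdjoint.hyperspecialSubgroup
          (integralClosure (v.adicCompletionIntegers K) (w.adicCompletion L))
          (T5HermitianThreeElements.J3 (algebraMap (v.adicCompletionIntegers K)
            (w.adicCompletion L) u₀))) ≃ₐ[k]
        T5HeckePermutationModule.heckeAlgebra k (T5UnitaryHeckeAdjoint.hyperspecialSubgroup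
          (integralClosure (v.adicCompletionIntegers K) (w.adicCompletion L)) H)),
      ∀ i : ℕ, b i = ε (T5HeckeBasisCells.heckeBasisCells
        (fun x hx => T5StarOfInvolution.isInteger_integralClosure_star σ
          (T5QuadraticAutomorphism.apply_apply h2 σ hσ) x hx)
        (algebraMap (v.adicCompletionIntegers K) (w.adicCompletion L) u₀)
        (T5StarOfInvolution.star_algebraMap_base σ (T5QuadraticAutomorphism.apply_apply h2 σ hσ)
          (u₀ : v.adicCompletionIntegers K))
        (T5GaloisCartanThree.algebraMap_unit_ne_zero (F := v.adicCompletion K)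
          (E := w.adicCompletion L) u₀)
        (T5GaloisCartanThree.isInteger_algebraMap (u₀ : v.adicCompletionIntegers K))
        (T5GaloisCartanThree.isInteger_algebraMap_unit_inv u₀)
        (T5GaloisCartanThree.irreducible_uniformiser
          (map_maximalIdeal_integralClosure_eq_of_irreducible v w hϖ hinert) hϖ)
        (T5StarOfInvolution.star_algebraMap_integralClosure σ
          (T5QuadraticAutomorphism.apply_apply h2 σ hσ) ϖ) k i) := by
  haveI := isLocalRing_integralClosure_adicCompletion v w
  exact T5InertHeckeCells.exists_basis_of_isotropic_of_unramified (v.adicCompletionIntegers K)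
    (v.adicCompletion K) (w.adicCompletion L) h2 σ hσ
    (map_maximalIdeal_integralClosure_eq_of_irreducible v w hϖ hinert) hϖ H k hH hHint hHdet hHinv
    x hx hx0

end Completion

end Summit.Ventures.HodgeRepro2.T5InertPlaceCompletionCells
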